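import Summits.ABC.IUTFork.Joshi.BundlingRings

/-!
# (7.5.1.6) `B_{L′} = ∏_{p ∈ 𝕍_ℚ} B̆_{L′,p}` DERIVED as a ring isomorphism (companion of `Joshi/BundlingRings.lean`)

Block E of the abc-iut cell (rung LADDER-ABC:A2.E; seat abc-iut-E-t13; DERIVABLE row J3:(7.5.1.6) of `plan/E/t13/INVENTORY.tsv`, which
`BundlingRings.lean` (p429549) only typed as the DEFINITION `PrimeBundlingFamily.AdelicBundleAll`). K. Joshi, *Construction of
Arithmetic Teichmüller Spaces III*, arXiv:2401.13508v4 (UNREFEREED, disputed; `Joshi2024ATS3`), p. 58 l. 48–62: «(7.5.1.5) `B̆_{L′,p} =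
⊕_{w ∈ 𝕍_{L′,p}} B_{E′_w}` … Then one can write the ring `B_{L′}` as (7.5.1.6) `B_{L′} = ∏_{p ∈ 𝕍_ℚ} B̆_{L′,p}`», where `B_{L′} = ∏_{w ∈
𝕍_{L′}} B_{L′_w}` (J3 Def. 6.9.1, E-t11/E-t12's `W`-indexed products) and `𝕍_{L′,p} = {w ∈ 𝕍_{L′} : w | p}` (7.5.1.1). CONTENT
(PROVED, nothing asserted): for any index map `below : W → P` («`p_w` the rational prime lying below `w`», p. 55 l. 3) and any
family of rings `B w`, the regrouping `∏_w B_w ≃+* ∏_p ∏_{w : p_w = p} B_w` (`regroup`), its compatibility with the coordinate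
projections, and the identification of its target with `PrimeBundlingFamily.AdelicBundleAll` for the fibre-indexed family. No side
taken on [IUTchIII] Cor. 3.12, on Joshi's claims or on Mochizuki's reports; typed ≠ proved ≠ endorsed. Standard axioms; sorry-free.
-/

noncomputable section

namespace Summit.ABC.IUTFork.Joshi.ATS3

variable {W P : Type} (below : W → P) (B : W → Type) [∀ x, CommRing (B x)]

/-- The fibre `𝕍_{L′,p} = {w ∈ 𝕍_{L′} : w | p}` of the index map `w ↦ p_w` ((7.5.1.1), p. 58 l. 2). [claim: Joshi2024ATS3, status: disputed] -/
abbrev fibre (p : P) : Type := {x : W // below x = p}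

/-- **(7.5.1.6) DERIVED**: the regrouping ring isomorphism `B_{L′} = ∏_{w ∈ 𝕍_{L′}} B_{L′_w} ≃ ∏_{p} ∏_{w ∈ 𝕍_{L′,p}} B_{L′_w} = ∏_p
B̆_{L′,p}` («Then one can write the ring `B_{L′}` as `∏_{p ∈ 𝕍_ℚ} B̆_{L′,p}`», p. 58 l. 58–62). PROVED (componentwise identity).
[folklore] -/
def regroup : ((x : W) → B x) ≃+* ((p : P) → (x : fibre below p) → B x.1) where
  toFun f p x := f x.1
  invFun g x := g (below x) ⟨x, rfl⟩
  left_inv f := rfl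
  right_inv g := by
    funext p x
    rcases x with ⟨x, rfl⟩
    rfl
  map_mul' _ _ := rfl
  map_add' _ _ := rfl

/-- The `(p, w)`-coordinate of the regrouped element is the `w`-coordinate (Rmk. 7.5.1.7, p. 58 l. 63–68: coordinates of `B̆_p`
«indexed by the set `{E′_w : w ∈ 𝕍_{L′,p}}`»). [folklore] -/
theorem regroup_apply (f : (x : W) → B x) (p : P) (x : fibre below p) : regroup below B f p x = f x.1 := rfl

/-- The inverse regrouping reads the `w`-coordinate in the block of `p_w`. [folklore] -/
theorem regroup_symm_apply (g : (p : P) → (x : fibre below p) → B x.1) (x : W) :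
    (regroup below B).symm g x = g (below x) ⟨x, rfl⟩ := rfl

/-- The block of `p` of the regrouped element is the restriction of `f` to the fibre `𝕍_{L′,p}` — i.e. the element of the prime
bundling ring `B̆_{L′,p} = PrimeBundlingDatum.BundleAll` for the fibre-indexed datum (its carrier is `(x : fibre below p) → B x.1`
by definition). [folklore] -/
theorem regroup_block (f : (x : W) → B x) (p : P) : regroup below B f p = fun x : fibre below p => f x.1 := rfl

/-- **(7.5.1.6) for `PrimeBundlingFamily`**: when the local data of a `PrimeBundlingFamily` are indexed by the fibres of `below` with
factor rings `B w`, its adelic carrier `AdelicBundleAll = (p : P) → (w : fibre p) → B w` is the target of `regroup`, so `B_{L′} ≃+*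
AdelicBundleAll` — stated on the carrier types (the family's other parameters play no role). PROVED. [folklore] -/
def regroupAdelic {lstar : ℕ} {Qp Bp : P → Type} [∀ p, Field (Qp p)] [∀ p, CommRing (Bp p)] [∀ p, Algebra (Qp p) (Bp p)]
    [∀ p, Fintype (fibre below p)] [∀ p, DecidableEq (fibre below p)] {E : (p : P) → fibre below p → Type}
    [∀ p x, Field (E p x)] [∀ p x, Algebra (Qp p) (E p x)] [∀ p (x : fibre below p), Algebra (Qp p) (B x.1)]
    [∀ p (x : fibre below p), Algebra (Bp p) (B x.1)] {T : P → Type} [∀ p, CommRing (T p)]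
    (A : PrimeBundlingFamily lstar P Qp Bp (fibre below) E (fun p (x : fibre below p) => B x.1) T) :
    ((x : W) → B x) ≃+* A.AdelicBundleAll :=
  regroup below B

end Summit.ABC.IUTFork.Joshi.ATS3

end
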